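import Summits.AnomalousDissipation.AnomalousDissipation.Theses.TwoAndHalfD
import Literature.Analysis.FluidPDE.TwoHalfNavierStokes
import Literature.Analysis.FluidPDE.LinearizedNSTorus
import Literature.Analysis.FluidPDE.LongTimeAverageNonneg
import Summits.AnomalousDissipation.AnomalousDissipation.Theorems.TwohalfdNeg.Negative.LoadBearing
import Summits.AnomalousDissipation.AnomalousDissipation.Theses.Neg
import HarnessLib.Audit

/-!
# Line `streamline-solvability-steady-branch` — skeleton for crux `TwoAndHalfD.TwohalfdNeg`
(item stmt-AnomalousDissipation-0211 = route `Neg` #3, routes route-AnomalousDissipation-TwoAndHalfD /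
route-AnomalousDissipation-Neg)

Crux (fixed): for EVERY steady smooth divergence-free mean-zero `x₃`-invariant force `f` on `T³`,
every `ν_j → 0` and every family of `x₃`-invariant global Leray–Hopf solutions `u_j` of
NS_{ν_j}(f) with `sup_j ⟨‖u_j‖²⟩ ≤ E`, the mean dissipation `⟨ν_j‖∇u_j‖²⟩ → 0`.

Idea (crux idea card `Cruxes/TwohalfdNeg/Ideas/streamline-solvability-steady-branch.md`, ideator 1,
round 1; triage r1-1/2/3: pass ×3 as the STEADY SUB-LINE).  In the `x₃`-invariant class
`u_j = (v_j, w_j)`: planar Navier–Stokes `v_j` forced by `g = (f₁,f₂)` plus a passive scalar `w_j`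
with the steady source `h = f₃`.  At every level `j` at which the planar flow SETTLES
(`v_j(t) → V_j` in `L²` as `t → ∞`) the long-time means are the values at a steady classical state
`(V_j, W_j)`, `⟪V_j, ∇W_j⟫ = ν_jΔW_j + h`, and steadiness makes every smooth FIRST INTEGRAL `η` of
`V_j` (`⟪V_j, ∇η⟫ = 0`) an admissible multiplier:

* (S) solvability defect   `∫ h η = ν_j ∫ ⟪∇η, ∇W_j⟫`            (test the steady equation with `η`),
* (C) coboundary pairing   `∫ ⟪V_j,∇Φ⟫ W_j = ν_j∫⟪∇Φ,∇W_j⟫ − ∫Φ h`  (test it with any smooth `Φ`),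
* (E) energy identity      `D_j := ν_j‖∇W_j‖² = ∫ h W_j`.

Split `h = η_j + ⟪V_j, ∇Φ_j⟫ + r_j` (first integral + orbit coboundary + remainder).  Then (E), (C),
(S) and Cauchy–Schwarz give the two FIXED-`ν` inequalities
  (I1) `D ≤ ‖W‖(‖η‖ + ‖r‖) + √(ν‖∇Φ‖²)·√D + |∫Φh|`,
  (I2) `‖η‖² ≤ √(ν‖∇η‖²)·√D + ‖r‖‖η‖`,
so the crux's bounded VARIANCE `‖W_j‖ ≤ √E` turns solvability into smallness: `D_j → 0` as soon as
`h` is, asymptotically, a first integral plus a coboundary AT RESOLUTION `√ν_j`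
(`√ν_j‖∇η_j‖ → 0`, `√ν_j‖∇Φ_j‖ → 0`, `‖r_j‖ → 0`, `∫Φ_jh → 0`) — the lever
`stub_orbitDecomposition` (Prandtl–Batchelor / Freidlin–Wentzell solvability pointed at the PASSIVE
sourced component; Reeb-graph geometry below the diffusive scale, which the Alexakis–Doering steady
budget `ν‖ΔV_j‖² ≤ ‖Δg‖√E` is bet to supply).

## Architecture (5 stubs + sorry-free glue)

Per level `j` the planar flow either SETTLES (`PlanarSettles (u j)`: the planar velocity components
converge in `L²(T³)` as `t → ∞`) or not.  On a loud subsequence one of the two happens infinitely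
often (`Filter.extraction_of_frequently_atTop`), and every hypothesis of the crux passes to
subsequences, so the crux splits into two branch statements of the crux's own shape:

* STEADY BRANCH (this line; `steadyBranch`, proved here from four stubs):
  `stub_steadyReduction` (settled `x₃`-invariant LH levels have steady classical planar data
  `(g,h,V_j,p_j,W_j)` carrying the means: `∫‖V_j‖², ∫W_j² ≤ E`,
  `meanDissipation = ν_j(‖∇V_j‖² + ‖∇W_j‖²)`) → `stub_steadyVelocityHalf` (Alexakis–Doering for
  steady states: `ν_j‖∇V_j‖² ≤ √ν_j E^{3/4}‖Δg‖^{1/2} → 0`) + the scalar half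
  `SteadyPlanarScalarNoAnomaly`, obtained as `stub_solvabilityClosure stub_orbitDecomposition`
  ((S),(C),(E),(I1),(I2) + limit algebra, applied to the decompositions the lever provides).
* UNSTEADY RESIDUAL (`stub_unsteadyResidual`): levels whose planar flow never settles.  NOT this
  line's deliverable: it is the socket for the merged log-cost line (`replica-log-cost-enstrophy-
  threshold` ≈ `log-kantorovich` ≈ `lusin-lipschitz`, adapter `age-decoupling-finite-window`:
  TwohalfdNeg on `{⟨‖ω_j‖_{L^p}⟩ = o(log 1/ν_j)}`) and it contains the crux's open core (time-
  dependent planar flows with `⟨‖ω_j‖²⟩ ≳ log²(1/ν_j)` at bounded energy — triage r1-3 "uncovered by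
  all six").

Composition `TwohalfdNeg_of : TwohalfdNeg` (sorry-free): contrapositive as in the kill shape
`Negative.twohalfdNeg_iff_not_twohalfdThesis` — `meanDissipation ≥ 0` and `↛ 0` give `ε > 0` with
`ε ≤ D_j` frequently; split the loud levels by `PlanarSettles`, extract a subsequence, apply the branch.

## Disproof.lean obligations honoured (cdisprove cycle 1; landed `Theorems/TwohalfdNeg/Negative/*` — `LoadBearing` imported, `ZeroMeanAndKillShape` read in tree)

* `twohalfdNeg_false_without_energyBound` (H := energy ceiling): USED twice — `stub_steadyReduction`
  turns `meanEnergy ≤ E` into `∫W_j² ≤ E` (the variance that closes (I1): `|∫η W| ≤ ‖η‖√E`) and into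
  `∫‖V_j‖² ≤ E` (the input of `stub_steadyVelocityHalf` and of the lever's Reeb geometry).  Without H
  the resonant closed cell `W ~ E[h|orbit]/(νk²)` of the laminar witness `u = f/(4π²ν)` is admissible.
* `twohalfdNeg_false_without_fixedForce` (H := ONE fixed force): USED in `stub_orbitDecomposition`,
  whose rates are for a FIXED smooth `h` quantified before `(ν_j, V_j, W_j)`: on the adversary's
  family `V_j = 0`, `h_j = 4π²cos(2π(j+1)x₀)`, `ν_j = (j+1)⁻²` every function is a first integral,
  the choice forced by (I2), `η_j ≈ h_j`, has `ν_j‖∇η_j‖² ≈ ν_j‖∇h_j‖² = 32π⁶ ↛ 0` — rate (a) fails exactly there.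
* `twohalfdNeg_false_without_zeroMeanForce` (H := `HasZeroMean f`): USED in `stub_steadyReduction` —
  the ramp `(0,0,cos 2πx₀/(4π²ν) + t)` HAS a settled planar part (`V = 0`) but no steady scalar with
  `∫W² ≤ E`; mean-zero `h` (from mean-zero `f`) is what makes `w_j(t)` converge (scalar mean conserved).
* `twohalfdNeg_false_without_vanishingViscosity`: `ν_j → 0` is used by both halves (rates × `√ν_j`).
* Kill shape §6 (`twohalfdNeg_iff_not_twohalfdThesis`): the composition is its proof pattern; the
  line refutes exactly the `X`-witnesses whose planar flow settles along a subsequence.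
* Paper sub-case (iii) of the Disproof docstring (purely vertical force, `g = 0`): INSIDE the steady
  branch — unforced planar NS settles to its conserved drift `m_j` (`PlanarSettles`), and the lever
  for `V_j = m_j` is the head/tail Fourier split written there (resonant modes `k·m_j = 0` are first
  integrals, `|k·m_j| ≥ δ_j` coboundaries, the rest is `r_j`).  E1SUBCASE_0211.md (first-shell planar
  force, Marchioro attraction) is inside it too.
* No stub is an instance refuted by the landed Negative lemmas (they delete crux hypotheses; every
  stub here keeps all of them and ADDS one).
-/

set_option linter.dupNamespace false

noncomputable section

open scoped BigOperators Topology ENNReal InnerProductSpace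
open Filter Set Function MeasureTheory

namespace Summit.AnomalousDissipation.AnomalousDissipation.Cruxes.TwohalfdNeg.StreamlineSolvabilitySteadyBranch

open Literature.Analysis.FunctionSpaces Literature.Analysis.FunctionSpaces.Torus
open Literature.Analysis.FluidPDE Literature.Analysis.FluidPDE.Torus
open Summit.AnomalousDissipation.AnomalousDissipation.Theses.TwoAndHalfD

/-- The flat three-torus (local notation). -/
local notation "𝕋³" => UnitAddTorus (Fin 3)
/-- The flat two-torus (local notation). -/
local notation "𝕋²" => UnitAddTorus (Fin 2)
/-- `ℝ³` (local notation). -/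
local notation "E³" => EuclideanSpace ℝ (Fin 3)
/-- `ℝ²` (local notation). -/
local notation "E²" => EuclideanSpace ℝ (Fin 2)

/-! ## §0 Vocabulary of the line -/

/-- **Level predicate — the planar flow SETTLES.**  The planar velocity components of the
space–time field `w` on `T³` converge in `L²(T³)`, as `t → ∞`, to the lift of a time-independent
planar field `V ∈ L²(T²)` (for an `x₃`-invariant Leray–Hopf level `u_j = (v_j, w_j)` this says
`v_j(t) → V` in `L²(T²)`; the scalar component is NOT asked to converge, and `V` is NOT asked to be
smooth or steady — both are proved in `stub_steadyReduction`, so that the negated predicate handed to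
`stub_unsteadyResidual` is as strong as possible).  `MemLp V 2` keeps the Bochner integral honest
(no junk `0` from a non-integrable integrand; `u_j(t) ∈ L²` for `t ≥ 0` by Leray–Hopf).  This is the
case split of the skeleton. [folklore] -/
@[folklore] def PlanarSettles (w : ℝ → 𝕋³ → E³) : Prop :=
  ∃ V : 𝕋² → E², MemLp V 2 volume ∧
    Tendsto (fun t => ∫ x, ‖planarProjE (w t x) - V (planarProj x)‖ ^ 2) atTop (𝓝 0)

/-- **Steady sourced scalar**: `W` is a smooth time-independent solution of
`∂ₜW + V·∇W = νΔW + h`, i.e. `⟪V, ∇W⟫ = νΔW + h` pointwise on `T²`. [folklore] -/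
@[folklore] def IsSteadyScalar (ν : ℝ) (V : 𝕋² → E²) (h W : 𝕋² → ℝ) : Prop :=
  IsSmooth W ∧ ∀ x, ⟪V x, Torus.gradient W x⟫_ℝ = ν * Torus.laplacian W x + h x

/-- **The 2-D core of the line (card P1, ideator's `SteadyPlanarScalarNoAnomaly` with the
zero-momentum clause REMOVED — swept/drifting steady states are included, triage r1-1 sharpen).**
Steady smooth force `g` (divergence free, mean zero) and source `h` (mean zero), FIXED and
quantified first; `ν_j → 0`; steady classical Navier–Stokes states `V_j` (pressure `p_j`,
`Torus.IsSteadyNSState`) of bounded energy — ANY enstrophy, any momentum — and steady classical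
scalars `W_j` of bounded variance.  THEN `ν_j‖∇W_j‖² → 0`. [folklore] -/
@[folklore] def SteadyPlanarScalarNoAnomaly : Prop :=
  ∀ (g : 𝕋² → E²) (h : 𝕋² → ℝ), IsSmooth g → IsDivFree g → HasZeroMean g →
    IsSmooth h → HasZeroMean h →
    ∀ (ν : ℕ → ℝ) (V : ℕ → 𝕋² → E²) (p W : ℕ → 𝕋² → ℝ),
      (∀ j, 0 < ν j) → Tendsto ν atTop (𝓝 0) →
      (∀ j, IsSteadyNSState (ν j) g (V j) (p j)) →
      (∀ j, IsSteadyScalar (ν j) (V j) h (W j)) →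
      (∃ E : ℝ, ∀ j, ∫ y, ‖V j y‖ ^ 2 ≤ E) →
      (∃ E : ℝ, ∀ j, ∫ y, (W j y) ^ 2 ≤ E) →
      Tendsto (fun j => ν j * scalarGradNormSq (W j)) atTop (𝓝 0)

/-- **THE LEVER, as a statement: orbit decomposition of the source below the diffusive scale.**
Same data as `SteadyPlanarScalarNoAnomaly` (the scalar `W_j` and both ceilings are AVAILABLE to the
construction — the card's stagnant-pocket and separatrix-layer counts use them).  Conclusion: smooth
`η_j`, `Φ_j` with `η_j` an exact FIRST INTEGRAL of `V_j` (`⟪V_j, ∇η_j⟫ = 0` pointwise — functions of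
the orbit, not only of the stream function: triage r1-2 sharpen) such that, with the remainder
`r_j := h − η_j − ⟪V_j, ∇Φ_j⟫`,
(a) `ν_j‖∇η_j‖² → 0`, (b) `ν_j‖∇Φ_j‖² → 0`, (c) `‖r_j‖²_{L²} → 0`, (d) `∫ Φ_j h → 0`:
asymptotically `h` is a first integral plus an orbit coboundary at resolution `√ν_j`. [folklore] -/
@[folklore] def OrbitDecompositionBelowDiffusiveScale : Prop :=
  ∀ (g : 𝕋² → E²) (h : 𝕋² → ℝ), IsSmooth g → IsDivFree g → HasZeroMean g →
    IsSmooth h → HasZeroMean h →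
    ∀ (ν : ℕ → ℝ) (V : ℕ → 𝕋² → E²) (p W : ℕ → 𝕋² → ℝ),
      (∀ j, 0 < ν j) → Tendsto ν atTop (𝓝 0) →
      (∀ j, IsSteadyNSState (ν j) g (V j) (p j)) →
      (∀ j, IsSteadyScalar (ν j) (V j) h (W j)) →
      (∃ E : ℝ, ∀ j, ∫ y, ‖V j y‖ ^ 2 ≤ E) →
      (∃ E : ℝ, ∀ j, ∫ y, (W j y) ^ 2 ≤ E) →
      ∃ (η Φ : ℕ → 𝕋² → ℝ),
        (∀ j, IsSmooth (η j)) ∧ (∀ j, IsSmooth (Φ j)) ∧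
        (∀ j y, ⟪V j y, Torus.gradient (η j) y⟫_ℝ = 0) ∧
        Tendsto (fun j => ν j * scalarGradNormSq (η j)) atTop (𝓝 0) ∧
        Tendsto (fun j => ν j * scalarGradNormSq (Φ j)) atTop (𝓝 0) ∧
        Tendsto (fun j => ∫ y, (h y - η j y - ⟪V j y, Torus.gradient (Φ j) y⟫_ℝ) ^ 2) atTop (𝓝 0) ∧
        Tendsto (fun j => ∫ y, Φ j y * h y) atTop (𝓝 0)

/-! ## §1 The five stubs -/

/-- **Stub 1 — THE LEVER (hardest; class XL): orbit decompositions below the diffusive scale exist.**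
Why plausible: (i) FIXED Reeb graph (first landable case, triage r1-3 sharpen): if `V_j → V` in `C¹`
with `V` a Morse stream function, take `η_j = F_δ∘ψ` (`F_δ` = orbit average of `h` as a function of
the orbit, flattened in `δ`-neighbourhoods of separatrix levels), `Φ_j` the orbit primitive of
`h − η_j` off those neighbourhoods: `‖∇η_j‖, ‖∇Φ_j‖ = O(δ⁻¹·log)`, `‖r_j‖² = O(δ + ‖V_j − V‖)`, and
(I2) forces `η_j → 0`; bookkeeping `A, B ~ ν^{-1/4}`, `D ≲ E ν^{1/2}` — the √κ flux law of
Childress 1979 / Shraiman 1987 / Rosenbluth et al. 1987, rigorous in Fannjiang–Papanicolaou 1994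
(both bounds) and Freidlin–Wentzell averaging on the Reeb graph.  (ii) DRIFT (`g = 0`, or swept states
`V_j = m_j + v'_j`, Disproof (iii) / `GravestModeLaminarAttractorSwept`): resonant Fourier modes
(`k·m_j = 0`) ARE smooth first integrals, modes with `|k·m_j| ≥ δ_j ≫ √ν_j` are coboundaries
(`Φ̂ = ĥ_k/(2πi k·m_j)`), the rest is `r_j`; for `|m_j| ≲ √ν_j` the variance ceiling is violated by the
explicit response (vacuous).  (iii) GENERAL `ν`-dependent steady states: the critical structure of
`ψ_j` is uncontrolled uniformly in `j` — separatrix webs of length `~1/ℓ_c` with `√(νℓ_c/U)` layers and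
stagnant pockets — and the BET (card K1) is that the crux's own clauses tame both: the steady
Alexakis–Doering budget `ν_j‖ΔV_j‖² = −∫⟪Δg,V_j⟫ ≤ ‖Δg‖√E` keeps `O(1)`-velocity cells coarser than
`Uν^{1/4} ≫ ν^{1/2}`, and a stagnant pocket `R` costs variance `≳ ν⁻²∫_R dist(·,∂R)⁴h²`, hence is
`√ν`-thin for the FIXED `h` — thin sets go into `r_j` at `L²`-cost = measure.  Why it might fail: slow
(`U → 0`) fine separatrix webs are not excluded by a MEAN budget (triage r1-1 doubt (b)); Pe ~ 1
micro-cell carpets renormalise `ν` but must be absorbed into `r_j`/`η_j` uniformly.  No tool beyond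
FP94/Freidlin–Wentzell exists for moving `ψ_j`.  Leans on: `Torus.gradient`, `IsSteadyNSState`,
`integral_inner_laplacian_convect` orthogonality (TorusEnstrophyOrthogonality, for the A–D budget),
Mathlib `MeasureTheory.condExp` w.r.t. `MeasurableSpace.comap ψ` and `Sard` (critical VALUES) — coarea
is NOT in Mathlib (go through smooth `F∘ψ`).  [cite: FannjiangPapanicolaou1994, SIAM J. Appl. Math. 54, Thms. 1.1–1.2 (√κ effective diffusivity of cellular flows, both bounds)] -/
theorem stub_orbitDecomposition : OrbitDecompositionBelowDiffusiveScale := by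
  sorry

/-- **Stub 2 — solvability closure (class M, provable now): the lever implies the 2-D core.**
For ONE steady state and ONE decomposition `h = η + ⟪V,∇Φ⟫ + r` (`η` a smooth first integral):
(E) `ν‖∇W‖² = ∫hW` (multiply `⟪V,∇W⟫ = νΔW + h` by `W`: `∫W⟪V,∇W⟫ = 0` by
`Torus.integral_mul_inner_gradient_self_eq_zero`, Green `integral_mul_laplacian_eq_neg_integral_inner_gradient`);
(S) `∫hη = ν∫⟪∇η,∇W⟫` (multiply by `η`; `∫η⟪V,∇W⟫ = −∫W⟪V,∇η⟫ = 0`, polarising the self identity);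
(C) `∫⟪V,∇Φ⟫W = ν∫⟪∇Φ,∇W⟫ − ∫Φh`; and `∫⟪V,∇Φ⟫η = −∫Φ⟪V,∇η⟫ = 0`.  Hence, with `D = ν‖∇W‖²`,
(I1) `D ≤ ‖W‖(‖η‖ + ‖r‖) + √(ν‖∇Φ‖²)√D + |∫Φh|`, (I2) `‖η‖² ≤ √(ν‖∇η‖²)√D + ‖r‖‖η‖`, and the a-priori
bound `D ≤ ‖h‖‖W‖ ≤ ‖h‖√E =: M` (Cauchy–Schwarz, `abs_integral_inner_le_sqrt_mul_sqrt` /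
`integral_mul_le_Lp_mul_Lq_of_nonneg`).  Limit algebra along `j`: (I2) gives
`‖η_j‖ ≤ ‖r_j‖ + (ν_j‖∇η_j‖²·M)^{1/4} → 0` (`x² ≤ α + βx ⇒ x ≤ β + √α`), then (I1) gives
`D_j ≤ √E(‖η_j‖ + ‖r_j‖) + √(ν_j‖∇Φ_j‖²)√M + |∫Φ_jh| → 0`.  The identities (S), (C) are the ideator's
`SteadySolvabilityDefect` / `SteadyCoboundaryPairing` (SketchIdeator1.lean, rc 0) with `F∘ψ` replaced by
an arbitrary first integral; land them first as `--supports` lemmas (triage r1-1/2/3: "cheap, permanent").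
[cite: Batchelor1956, J. Fluid Mech. 1, 177–190, §2 (solvability condition on closed streamlines)] -/
theorem stub_solvabilityClosure :
    OrbitDecompositionBelowDiffusiveScale → SteadyPlanarScalarNoAnomaly := by
  sorry

/-- **Stub 3 — velocity half for steady states (class M, provable now; Alexakis–Doering 2006 §2 for
equilibria).**  For steady classical NS states `V_j` under a fixed smooth `g` with `∫‖V_j‖² ≤ E` and
`ν_j → 0`: `ν_j‖∇V_j‖² → 0`.  Proof: pair the steady momentum equation
`(V·∇)V = νΔV − ∇p + g` (`timeDerivWithin univ (fun _ => V) = 0`) with `ΔV`: the trilinear term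
vanishes on `T²` (`b(u,u,Au) = 0`, `TorusEnstrophyOrthogonality`), the pressure term vanishes
(`div ΔV = 0`, `integral_inner_gradient_eq_zero_of_isDivFree`), so
`ν‖ΔV‖² = −∫⟪g,ΔV⟫ = −∫⟪Δg,V⟫ ≤ ‖Δg‖₂√E`; and `‖∇V‖² = −∫⟪V,ΔV⟫ ≤ ‖V‖‖ΔV‖`, whence
`ν_j‖∇V_j‖² ≤ √ν_j · E^{3/4}‖Δg‖₂^{1/2} → 0`.  Any momentum (the identities are blind to the mean).
Leans on: `Torus.IsSteadyNSState`, `Torus.gradNormSq`, `TorusEnstrophyOrthogonality`,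
`integral_inner_laplacian` Green identities (TorusCalculusProofs). [cite: AlexakisDoering2006PLA, §2 displays (VBI) and (trickI), steady case] -/
theorem stub_steadyVelocityHalf :
    ∀ (g : 𝕋² → E²), IsSmooth g →
      ∀ (ν : ℕ → ℝ) (V : ℕ → 𝕋² → E²) (p : ℕ → 𝕋² → ℝ),
        (∀ j, 0 < ν j) → Tendsto ν atTop (𝓝 0) →
        (∀ j, IsSteadyNSState (ν j) g (V j) (p j)) →
        (∃ E : ℝ, ∀ j, ∫ y, ‖V j y‖ ^ 2 ≤ E) →
        Tendsto (fun j => ν j * gradNormSq (V j)) atTop (𝓝 0) := by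
  sorry

/-- **Stub 4 — steady reduction (class L; standard 2-D theory at FIXED `ν > 0`, card K3).**
An `x₃`-invariant global Leray–Hopf family under the fixed `x₃`-invariant smooth solenoidal mean-zero
force `f`, with `meanEnergy ≤ E`, ALL of whose levels have a settling planar flow, is carried by steady
classical planar data: `f = twoHalf g h` (`eq_twoHalf_of_forall_add_single`; `g` smooth solenoidal
mean-zero, `h` smooth mean-zero), and for each `j` a steady classical NS state `(V_j, p_j)` under `g`
at `ν_j` and a steady classical scalar `W_j` (source `h`) with `∫‖V_j‖² ≤ E`, `∫W_j² ≤ E` and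
`meanDissipation ν_j u_j = ν_j(‖∇V_j‖² + ‖∇W_j‖²)`.  Proof content: (1) the planar/vertical parts of
`u_j` are THE 2-D Leray–Hopf solution `v_j` (Lions–Prodi, smooth for `t > 0`) and the unique energy
solution `w_j` of the sourced advection–diffusion equation; (2) `v_j(t) → V_j` in `L²` ⇒ `V_j` lies in
the `ω`-limit set ⊆ global attractor (bounded in every `H^s` for smooth `g`), is an equilibrium
(limit of a convergent trajectory of a continuous semiflow) and the convergence holds in `H¹`
(interpolation against `H²` bounds); (3) scalar: `δ = w_j − W_j` (W_j the steady response, shifted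
by the conserved scalar mean) obeys `½ d‖δ‖²/dt ≤ −4π²ν_j‖δ − δ̄‖²… + ‖v_j − V_j‖₂‖∇W_j‖_∞‖δ‖` ⇒
`δ → 0` in `L²`, then in `H¹`; (4) Cesàro means of convergent locally integrable functions converge:
`meanEnergy u_j = ∫‖V_j‖² + ∫W_j²` (`integral_norm_sq_twoHalf`) and `meanDissipation = ν_j ·
gradNormSq (twoHalf V_j W_j) = ν_j(gradNormSq V_j + scalarGradNormSq W_j)` (`toReal_eGradNormSq_twoHalf`).
Uses `HasZeroMean f` essentially (Disproof §5 ramp: settled planar part, no steady scalar).  Why it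
might fail: only by formalisation debt (2-D LH ⇒ strong/smooth, absorbing balls in `H²`, the
`x₃`-invariant LH ⇒ 2-D LH splitting are partly in tree: `lions_prodi_uniqueness_torus2`,
`fmrt_enstrophy_balance_torus2_holds`, `TwoHalfWeakEuler` axis averages).  Leans on:
`Torus.IsGlobalLerayHopf`, `eq_twoHalf_of_forall_add_single`, `integral_norm_sq_twoHalf`,
`toReal_eGradNormSq_twoHalf`, `meanEnergy_eq_longTimeAvgSup`, FoiasManleyRosaTemam2001 Ch. II–III.
[cite: FoiasManleyRosaTemam2001, Ch. II Thm. 7.4 and Ch. III §3 (2-D global attractor, regularity)] -/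
theorem stub_steadyReduction :
    ∀ f : 𝕋³ → E³, (∀ (s : UnitAddCircle) (x : 𝕋³), f (x + Pi.single (2 : Fin 3) s) = f x) →
      IsSmooth f → IsDivFree f → HasZeroMean f →
      ∀ (ν : ℕ → ℝ) (u₀ : ℕ → 𝕋³ → E³) (u : ℕ → ℝ → 𝕋³ → E³),
        (∀ j, 0 < ν j) →
        (∀ j, IsGlobalLerayHopf (ν j) (fun _ => f) (u₀ j) (u j)) →
        (∀ j (t : ℝ) (s : UnitAddCircle) (x : 𝕋³), u j t (x + Pi.single (2 : Fin 3) s) = u j t x) →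
        ∀ E : ℝ, (∀ j, meanEnergy (u j) ≤ E) →
        (∀ j, PlanarSettles (u j)) →
        ∃ (g : 𝕋² → E²) (h : 𝕋² → ℝ) (V : ℕ → 𝕋² → E²) (p W : ℕ → 𝕋² → ℝ),
          IsSmooth g ∧ IsDivFree g ∧ HasZeroMean g ∧ IsSmooth h ∧ HasZeroMean h ∧
          f = twoHalf g h ∧
          (∀ j, IsSteadyNSState (ν j) g (V j) (p j)) ∧
          (∀ j, IsSteadyScalar (ν j) (V j) h (W j)) ∧
          (∀ j, ∫ y, ‖V j y‖ ^ 2 ≤ E) ∧ (∀ j, ∫ y, (W j y) ^ 2 ≤ E) ∧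
          (∀ j, meanDissipation (ν j) (u j) = ν j * gradNormSq (V j) + ν j * scalarGradNormSq (W j)) := by
  sorry

/-- **Stub 5 — UNSTEADY RESIDUAL (class XL; NOT this line's deliverable — the socket for the sibling
lines and the crux's open core).**  The crux restricted to families NONE of whose levels has a
settling planar flow.  What is known: the velocity half is `O(ν^{1/2})` regardless
(`Literature.Barriers.AnomalousDissipation.AlexakisDoering2006_energyDissipationBound`); the scalar
half is proved on paper on `{⟨‖ω_j‖_{L^p}⟩ = o(log 1/ν_j)}` by the merged log-cost line (two-replica
FDR + Crippa–De Lellis log cost; cards replica-log-cost-enstrophy-threshold / log-kantorovich /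
lusin-lipschitz, reduction (★★) of age-decoupling-finite-window), which contains every settled or
unsettled family with `ν`-uniform planar `W^{1,p}` bounds (single-shell `g`: SINGLE_SHELL_2HALFD.md).
Why it might fail: FALSE iff an `X`-witness exists whose planar flow never settles — the
Alexakis–Doering-extremal scenario of a time-dependent bounded-energy condensate with
`⟨‖ω_j‖²⟩ ≳ log²(1/ν_j)` mixing the sourced component at a `ν`-uniform rate (route TwoAndHalfD #2/#3;
BruèDeLellis2023 Q2.1, printed open).  A proof must use exact steadiness and `ν`-independence of `f`
(`Cheskidov2023_thm13_not_forceRobustNoAnomaly`; Disproof `_false_without_fixedForce`).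
[cite: Cheskidov2023, Thm. 1.3 (the force-robust class is anomalous; arXiv:2311.04182)] -/
theorem stub_unsteadyResidual :
    ∀ f : 𝕋³ → E³, (∀ (s : UnitAddCircle) (x : 𝕋³), f (x + Pi.single (2 : Fin 3) s) = f x) →
      IsSmooth f → IsDivFree f → HasZeroMean f →
      ∀ (ν : ℕ → ℝ) (u₀ : ℕ → 𝕋³ → E³) (u : ℕ → ℝ → 𝕋³ → E³),
        (∀ j, 0 < ν j) → Tendsto ν atTop (𝓝 0) →
        (∀ j, IsGlobalLerayHopf (ν j) (fun _ => f) (u₀ j) (u j)) →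
        (∀ j (t : ℝ) (s : UnitAddCircle) (x : 𝕋³), u j t (x + Pi.single (2 : Fin 3) s) = u j t x) →
        (∃ E : ℝ, ∀ j, meanEnergy (u j) ≤ E) →
        (∀ j, ¬ PlanarSettles (u j)) →
        Tendsto (fun j => meanDissipation (ν j) (u j)) atTop (𝓝 0) := by
  sorry

/-! ## §2 Glue (sorry-free) -/

/-- **The 2-D core from the lever** (Stub 2 applied to Stub 1). [folklore] -/
theorem steadyPlanarScalarNoAnomaly : SteadyPlanarScalarNoAnomaly :=
  stub_solvabilityClosure stub_orbitDecomposition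

/-- **THE STEADY BRANCH of the crux**: an admissible family ALL of whose levels have a settling
planar flow has `meanDissipation → 0`.  Proof: Stub 4 hands steady data carrying the means; the
velocity half (Stub 3) and the scalar half (Stubs 1–2) both tend to `0`; add. [folklore] -/
theorem steadyBranch :
    ∀ f : 𝕋³ → E³, (∀ (s : UnitAddCircle) (x : 𝕋³), f (x + Pi.single (2 : Fin 3) s) = f x) →
      IsSmooth f → IsDivFree f → HasZeroMean f →
      ∀ (ν : ℕ → ℝ) (u₀ : ℕ → 𝕋³ → E³) (u : ℕ → ℝ → 𝕋³ → E³),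
        (∀ j, 0 < ν j) → Tendsto ν atTop (𝓝 0) →
        (∀ j, IsGlobalLerayHopf (ν j) (fun _ => f) (u₀ j) (u j)) →
        (∀ j (t : ℝ) (s : UnitAddCircle) (x : 𝕋³), u j t (x + Pi.single (2 : Fin 3) s) = u j t x) →
        (∃ E : ℝ, ∀ j, meanEnergy (u j) ≤ E) →
        (∀ j, PlanarSettles (u j)) →
        Tendsto (fun j => meanDissipation (ν j) (u j)) atTop (𝓝 0) := by
  intro f hfinv hfs hfd hfm ν u₀ u hν hν0 hLH huinv hE hset
  obtain ⟨E, hE⟩ := hE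
  obtain ⟨g, h, V, p, W, hgs, hgd, hgm, hhs, hhm, -, hNS, hW, hVE, hWE, hD⟩ :=
    stub_steadyReduction f hfinv hfs hfd hfm ν u₀ u hν hLH huinv E hE hset
  have hscal : Tendsto (fun j => ν j * scalarGradNormSq (W j)) atTop (𝓝 0) :=
    steadyPlanarScalarNoAnomaly g h hgs hgd hgm hhs hhm ν V p W hν hν0 hNS hW ⟨E, hVE⟩ ⟨E, hWE⟩
  have hvel : Tendsto (fun j => ν j * gradNormSq (V j)) atTop (𝓝 0) :=
    stub_steadyVelocityHalf g hgs ν V p hν hν0 hNS ⟨E, hVE⟩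
  have hsum := hvel.add hscal
  rw [add_zero] at hsum
  exact hsum.congr (fun j => (hD j).symm)

/-- **Composition: the five stubs prove the crux `TwohalfdNeg` (by name).**  Contrapositive in the
shape of `Negative.twohalfdNeg_iff_not_twohalfdThesis`: if `meanDissipation ↛ 0` then, all values
being `≥ 0` (`meanDissipation_nonneg`), some `ε > 0` is undershot only on a non-cofinite set, i.e.
`ε ≤ meanDissipation` FREQUENTLY; frequently the loud level settles or frequently it does not; extract a
subsequence (`Filter.extraction_of_frequently_atTop`) — every hypothesis of the crux passes to
subsequences and `ν ∘ φ → 0` — and apply `steadyBranch`, resp. `stub_unsteadyResidual`. -/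
theorem TwohalfdNeg_of : TwohalfdNeg := by
  intro f hfinv hfs hfd hfm ν u₀ u hν hν0 hLH huinv hE
  by_contra hnt
  -- `meanDissipation ↛ 0` with nonnegative values: some `ε > 0` with `ε ≤ meanDissipation` frequently
  have hfreq : ∃ ε : ℝ, 0 < ε ∧ ∃ᶠ j in atTop, ε ≤ meanDissipation (ν j) (u j) := by
    by_contra hall
    push Not at hall
    apply hnt
    rw [tendsto_order]
    exact ⟨fun b hb => Eventually.of_forall fun j => hb.trans_le (meanDissipation_nonneg (hν j).le _),
      fun b hb => hall b hb⟩
  obtain ⟨ε, hε, hfr⟩ := hfreq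
  -- split the loud levels according to whether their planar flow settles
  have hsplit : (∃ᶠ j in atTop, ε ≤ meanDissipation (ν j) (u j) ∧ PlanarSettles (u j)) ∨
      (∃ᶠ j in atTop, ε ≤ meanDissipation (ν j) (u j) ∧ ¬ PlanarSettles (u j)) := by
    rw [← frequently_or_distrib]
    refine hfr.mono fun j hj => ?_
    by_cases hs : PlanarSettles (u j)
    · exact Or.inl ⟨hj, hs⟩
    · exact Or.inr ⟨hj, hs⟩
  rcases hsplit with hA | hB
  · -- steady branch along the extracted subsequence
    obtain ⟨φ, hφ, hφp⟩ := extraction_of_frequently_atTop hA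
    have ht := steadyBranch f hfinv hfs hfd hfm (ν ∘ φ) (u₀ ∘ φ) (u ∘ φ) (fun i => hν (φ i))
      (hν0.comp hφ.tendsto_atTop) (fun i => hLH (φ i)) (fun i => huinv (φ i))
      ⟨hE.choose, fun i => hE.choose_spec (φ i)⟩ (fun i => (hφp i).2)
    obtain ⟨i, hi⟩ := (ht.eventually (gt_mem_nhds hε)).exists
    exact (not_lt.2 (hφp i).1) hi
  · -- unsteady residual along the extracted subsequence
    obtain ⟨φ, hφ, hφp⟩ := extraction_of_frequently_atTop hB
    have ht := stub_unsteadyResidual f hfinv hfs hfd hfm (ν ∘ φ) (u₀ ∘ φ) (u ∘ φ) (fun i => hν (φ i))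
      (hν0.comp hφ.tendsto_atTop) (fun i => hLH (φ i)) (fun i => huinv (φ i))
      ⟨hE.choose, fun i => hE.choose_spec (φ i)⟩ (fun i => (hφp i).2)
    obtain ⟨i, hi⟩ := (ht.eventually (gt_mem_nhds hε)).exists
    exact (not_lt.2 (hφp i).1) hi

/-- Route `Neg` files the same crux verbatim (`Neg.TwohalfdNeg`, its #3; `Negative.twohalfdNeg_neg_iff`
is `Iff.rfl`); the skeleton closes it too, by definitional unfolding. [folklore] -/
theorem neg_TwohalfdNeg_of : Summit.AnomalousDissipation.AnomalousDissipation.Theses.Neg.TwohalfdNeg :=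
  fun f hfinv hs hd hz ν u₀ u hν hν0 hLH huinv hE => TwohalfdNeg_of f hfinv hs hd hz ν u₀ u hν hν0 hLH huinv hE

end Summit.AnomalousDissipation.AnomalousDissipation.Cruxes.TwohalfdNeg.StreamlineSolvabilitySteadyBranch

end
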